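import Mathlib
import HarnessLib
import Literature.MathematicalPhysics.QuantumLattice.FermiRG.FST2Regularity
import Summits.HubbardSuperconductivity.HubbardSuperconductivity.Theorems.KLProgrammeFermiSeaConvex
import Summits.HubbardSuperconductivity.HubbardSuperconductivity.Theorems.KLProgrammeFermiSurfaceFST2

/-!
# Route `KLProgramme` (cruxes K1/K3): FST II's GLOBAL strict convexity hypothesis (A3) — as TYPED,
# `FermiRG.HypA3Global` — holds for the Hubbard band at every level `-4 < μ < 0`

Cell `gate-hubbard-kl`, risk-register item r2 (the Fermi-surface hypotheses the typed FST statements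
consume). Feldman–Salmhofer–Trubowitz II (CPAM 51 (1998), arXiv:cond-mat/9701073, p.7 L59–60) use
Assumption (A3) in two forms: the LOCAL curvature condition (`FermiRG.HypA3`, instantiated for the Hubbard
band in `KLProgrammeFermiSurfaceFST2Regularity`, `klfs_hypA3`) and its printed consequence "`S` bounds a
strictly convex region", which for a periodic band is an independent statement and is typed separately in
`FermiRG/FST2Regularity.lean` as

  `HypA3Global cr e := ∃ C, IsCompact C ∧ StrictConvex ℝ C ∧ (interior C).Nonempty ∧ cr.fermiSurfaceRep e = frontier C`

— a hypothesis of EVERY typed FST II theorem (`VolumeBound`, Theorem 1.2, …). This file proves it for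
`e = squareDispersion 1 0 · - μ` on `Crystal.cubic 2`, `-4 < μ < 0` (`klfs_hypA3Global`), with the body

  `C_μ = {p : |p₀| + |p₁| ≤ π, cos p₀ + cos p₁ ≥ -μ/2}`

(the closed free Fermi sea inside the cell). Ingredients: `log ∘ cos` is STRICTLY concave on `(-π/2, π/2)`
(`klfs_strictConcaveOn_log_cos`; the non-strict version is eng's `muWin_concaveOn_log_cos`), hence
`cos p₀ + cos p₁ = 2 cos u cos v` (`u, v = (p₀ ± p₁)/2`) is strictly quasi-concave on the open diamond
(`klfs_cos_add_cos_combo_gt`: a proper convex combination of two distinct points of `C_μ` has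
`cos + cos > -μ/2`); `C_μ` is compact, lies in the OPEN diamond (`abs_add_abs_lt_pi_of_cos_add_cos_pos`),
contains `0` in its interior, its interior is exactly `{cos + cos > -μ/2}` (a level point is approached from
outside by pushing one non-zero coordinate away from `0`, `klfs_exists_near_below`), so its frontier is the
level set `{cos p₀ + cos p₁ = -μ/2} = S ∩ F`. No definitions; everything PROVED. [folklore]
-/

noncomputable section

open Real Set

-- the tree's namespace `Summit.<Summit>.<Problem>.Theorems` repeats the summit name by design (D-0017)
set_option linter.dupNamespace false

namespace Summit.HubbardSuperconductivity.HubbardSuperconductivity.Theorems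

open Literature.MathematicalPhysics.QuantumLattice

/-! ### §1 Strict concavity of `log ∘ cos` and strict quasi-concavity of `cos p₀ + cos p₁` -/

/-- `log ∘ cos` is STRICTLY concave on `(-π/2, π/2)`: its derivative `-tan` is strictly decreasing.
[folklore] -/
theorem klfs_strictConcaveOn_log_cos :
    StrictConcaveOn ℝ (Ioo (-(π / 2)) (π / 2)) (fun u => Real.log (Real.cos u)) := by
  have hD : Convex ℝ (Ioo (-(π / 2)) (π / 2)) := convex_Ioo _ _
  have hderiv : ∀ x ∈ Ioo (-(π / 2)) (π / 2),
      HasDerivAt (fun u => Real.log (Real.cos u)) (-Real.tan x) x := by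
    intro x hx
    have hc : Real.cos x ≠ 0 := (Real.cos_pos_of_mem_Ioo hx).ne'
    have := (Real.hasDerivAt_cos x).log hc
    convert this using 1
    rw [Real.tan_eq_sin_div_cos]; ring
  refine StrictAntiOn.strictConcaveOn_of_deriv hD ?_ ?_
  · exact ContinuousOn.log Real.continuous_cos.continuousOn
      fun x hx => (Real.cos_pos_of_mem_Ioo hx).ne'
  · rw [interior_Ioo]
    intro x hx y hy hxy
    rw [(hderiv x hx).deriv, (hderiv y hy).deriv]
    exact neg_lt_neg (Real.strictMonoOn_tan hx hy hxy)

/-- On the open diamond `|p₀| + |p₁| < π` the half-sum and half-difference lie in `(-π/2, π/2)`. [folklore] -/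
theorem klfs_halfSum_mem_Ioo {x₀ x₁ : ℝ} (h : |x₀| + |x₁| < π) :
    (x₀ + x₁) / 2 ∈ Ioo (-(π / 2)) (π / 2) ∧ (x₀ - x₁) / 2 ∈ Ioo (-(π / 2)) (π / 2) := by
  have h1 := abs_add_le x₀ x₁
  have h2 := abs_sub x₀ x₁
  have h1' := abs_lt.1 (h1.trans_lt h)
  have h2' := abs_lt.1 (h2.trans_lt h)
  exact ⟨⟨by linarith, by linarith⟩, ⟨by linarith, by linarith⟩⟩

/-- `log ((cos p₀ + cos p₁)/2) = log cos u + log cos v`, `u, v = (p₀ ± p₁)/2`, on the open diamond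
(sum-to-product; both factors are positive there). [folklore] -/
theorem klfs_log_cos_add_cos {x₀ x₁ : ℝ} (h : |x₀| + |x₁| < π) :
    Real.log ((Real.cos x₀ + Real.cos x₁) / 2) =
      Real.log (Real.cos ((x₀ + x₁) / 2)) + Real.log (Real.cos ((x₀ - x₁) / 2)) := by
  obtain ⟨hu, hv⟩ := klfs_halfSum_mem_Ioo h
  have hcu := Real.cos_pos_of_mem_Ioo hu
  have hcv := Real.cos_pos_of_mem_Ioo hv
  rw [Real.cos_add_cos, show 2 * Real.cos ((x₀ + x₁) / 2) * Real.cos ((x₀ - x₁) / 2) / 2 =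
    Real.cos ((x₀ + x₁) / 2) * Real.cos ((x₀ - x₁) / 2) by ring, Real.log_mul hcu.ne' hcv.ne']

/-- `cos p₀ + cos p₁ > 0` on the open diamond. [folklore] -/
theorem klfs_cos_add_cos_pos {x₀ x₁ : ℝ} (h : |x₀| + |x₁| < π) : 0 < Real.cos x₀ + Real.cos x₁ := by
  obtain ⟨hu, hv⟩ := klfs_halfSum_mem_Ioo h
  rw [Real.cos_add_cos]
  exact mul_pos (mul_pos two_pos (Real.cos_pos_of_mem_Ioo hu)) (Real.cos_pos_of_mem_Ioo hv)

/-- A proper convex combination of two points of the open diamond lies in the open diamond. [folklore] -/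
theorem klfs_diamond_combo {x y : Momentum} {a b : ℝ} (hx : |x 0| + |x 1| < π) (hy : |y 0| + |y 1| < π)
    (ha : 0 < a) (hb : 0 < b) (hab : a + b = 1) :
    |(a • x + b • y) 0| + |(a • x + b • y) 1| < π := by
  have e0 : (a • x + b • y) 0 = a * x 0 + b * y 0 := by simp
  have e1 : (a • x + b • y) 1 = a * x 1 + b * y 1 := by simp
  rw [e0, e1]
  have h0 : |a * x 0 + b * y 0| ≤ a * |x 0| + b * |y 0| := by
    refine (abs_add_le _ _).trans ?_
    rw [abs_mul, abs_mul, abs_of_pos ha, abs_of_pos hb]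
  have h1 : |a * x 1 + b * y 1| ≤ a * |x 1| + b * |y 1| := by
    refine (abs_add_le _ _).trans ?_
    rw [abs_mul, abs_mul, abs_of_pos ha, abs_of_pos hb]
  have hxa : a * |x 0| + a * |x 1| < a * π := by
    have := mul_lt_mul_of_pos_left hx ha; linarith [mul_add a (|x 0|) (|x 1|)]
  have hyb : b * |y 0| + b * |y 1| < b * π := by
    have := mul_lt_mul_of_pos_left hy hb; linarith [mul_add b (|y 0|) (|y 1|)]
  have hπ : a * π + b * π = π := by rw [← add_mul, hab, one_mul]
  linarith

/-- **Strict quasi-concavity of `cos p₀ + cos p₁` on the open diamond**: if `x ≠ y` lie in the open diamond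
with `cos + cos ≥ c > 0` at both, every proper convex combination has `cos + cos > c` — from the strict
concavity of `log cos u + log cos v` in whichever of the coordinates `u, v = (p₀ ± p₁)/2` differs.
[folklore] -/
theorem klfs_cos_add_cos_combo_gt {x y : Momentum} {c a b : ℝ} (hc : 0 < c)
    (hx : |x 0| + |x 1| < π) (hy : |y 0| + |y 1| < π) (hxy : x ≠ y)
    (hcx : c ≤ Real.cos (x 0) + Real.cos (x 1)) (hcy : c ≤ Real.cos (y 0) + Real.cos (y 1))
    (ha : 0 < a) (hb : 0 < b) (hab : a + b = 1) :
    c < Real.cos ((a • x + b • y) 0) + Real.cos ((a • x + b • y) 1) := by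
  have e0 : (a • x + b • y) 0 = a * x 0 + b * y 0 := by simp
  have e1 : (a • x + b • y) 1 = a * x 1 + b * y 1 := by simp
  have hz := klfs_diamond_combo hx hy ha hb hab
  rw [e0, e1] at hz ⊢
  obtain ⟨hux, hvx⟩ := klfs_halfSum_mem_Ioo hx
  obtain ⟨huy, hvy⟩ := klfs_halfSum_mem_Ioo hy
  -- the two half-coordinates cannot both agree
  have hne : (x 0 + x 1) / 2 ≠ (y 0 + y 1) / 2 ∨ (x 0 - x 1) / 2 ≠ (y 0 - y 1) / 2 := by
    by_contra h
    push Not at h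
    apply hxy
    have h0 : x 0 = y 0 := by linarith [h.1, h.2]
    have h1 : x 1 = y 1 := by linarith [h.1, h.2]
    ext i
    fin_cases i
    · exact h0
    · exact h1
  have F := klfs_strictConcaveOn_log_cos
  have Fc := F.concaveOn
  have huz : (a * x 0 + b * y 0 + (a * x 1 + b * y 1)) / 2 = a • ((x 0 + x 1) / 2) + b • ((y 0 + y 1) / 2) := by
    simp only [smul_eq_mul]; ring
  have hvz : (a * x 0 + b * y 0 - (a * x 1 + b * y 1)) / 2 = a • ((x 0 - x 1) / 2) + b • ((y 0 - y 1) / 2) := by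
    simp only [smul_eq_mul]; ring
  have key : a * (Real.log (Real.cos ((x 0 + x 1) / 2)) + Real.log (Real.cos ((x 0 - x 1) / 2))) +
      b * (Real.log (Real.cos ((y 0 + y 1) / 2)) + Real.log (Real.cos ((y 0 - y 1) / 2))) <
      Real.log (Real.cos ((a * x 0 + b * y 0 + (a * x 1 + b * y 1)) / 2)) +
        Real.log (Real.cos ((a * x 0 + b * y 0 - (a * x 1 + b * y 1)) / 2)) := by
    rw [huz, hvz]
    rcases hne with h | h
    · have h1 := F.2 hux huy h ha hb hab
      have h2 := Fc.2 hvx hvy ha.le hb.le hab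
      simp only [smul_eq_mul] at h1 h2 ⊢
      linarith
    · have h1 := Fc.2 hux huy ha.le hb.le hab
      have h2 := F.2 hvx hvy h ha hb hab
      simp only [smul_eq_mul] at h1 h2 ⊢
      linarith
  have hx' : Real.log (c / 2) ≤ Real.log (Real.cos ((x 0 + x 1) / 2)) + Real.log (Real.cos ((x 0 - x 1) / 2)) := by
    rw [← klfs_log_cos_add_cos hx]
    exact Real.log_le_log (by positivity) (by linarith)
  have hy' : Real.log (c / 2) ≤ Real.log (Real.cos ((y 0 + y 1) / 2)) + Real.log (Real.cos ((y 0 - y 1) / 2)) := by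
    rw [← klfs_log_cos_add_cos hy]
    exact Real.log_le_log (by positivity) (by linarith)
  have hzpos := klfs_cos_add_cos_pos hz
  have hlog : Real.log (c / 2) < Real.log ((Real.cos (a * x 0 + b * y 0) + Real.cos (a * x 1 + b * y 1)) / 2) := by
    rw [klfs_log_cos_add_cos hz]
    have hc2 : a * Real.log (c / 2) + b * Real.log (c / 2) = Real.log (c / 2) := by rw [← add_mul, hab, one_mul]
    nlinarith [mul_le_mul_of_nonneg_left hx' ha.le, mul_le_mul_of_nonneg_left hy' hb.le]
  have := (Real.log_lt_log_iff (by positivity) (by positivity)).1 hlog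
  linarith

/-! ### §2 Approaching a level point from outside the sea -/

/-- Pushing a non-zero coordinate `t` away from `0` by `s > 0` (staying in `[-π, π]`) strictly decreases
`cos`. [folklore] -/
theorem klfs_cos_push_lt {t s : ℝ} (ht : t ≠ 0) (hs : 0 < s) (hπ : |t| + s ≤ π) :
    Real.cos (t + (if 0 < t then s else -s)) < Real.cos t := by
  have key : |t + (if 0 < t then s else -s)| = |t| + s := by
    split_ifs with h
    · rw [abs_of_pos h, abs_of_pos (by linarith)]
    · have h' : t < 0 := lt_of_le_of_ne (not_lt.1 h) ht
      rw [abs_of_neg h', abs_of_neg (by linarith)]; ring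
  rw [← Real.cos_abs (t + _), key, ← Real.cos_abs t]
  exact Real.cos_lt_cos_of_nonneg_of_le_pi (abs_nonneg t) hπ (by linarith)

/-- **Every point of the open diamond other than `0` is a limit of points with strictly smaller
`cos p₀ + cos p₁`**: push a non-zero coordinate away from `0`. [folklore] -/
theorem klfs_exists_near_below {p : Momentum} (hp : |p 0| + |p 1| < π) (hne : p ≠ 0) {δ : ℝ} (hδ : 0 < δ) :
    ∃ q : Momentum, dist q p < δ ∧ Real.cos (q 0) + Real.cos (q 1) < Real.cos (p 0) + Real.cos (p 1) := by
  -- a non-zero coordinate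
  have hcoord : p 0 ≠ 0 ∨ p 1 ≠ 0 := by
    by_contra h
    push Not at h
    apply hne
    ext i
    fin_cases i
    · simpa using h.1
    · simpa using h.2
  -- the step
  set s := min (δ / 2) ((π - |p 0| - |p 1|) / 2) with hs
  have hs0 : 0 < s := lt_min (by linarith) (by linarith)
  have hsδ : s ≤ δ / 2 := min_le_left _ _
  have hsπ : s ≤ (π - |p 0| - |p 1|) / 2 := min_le_right _ _
  rcases hcoord with h0 | h1
  · refine ⟨p + EuclideanSpace.single (0 : Fin 2) (if 0 < p 0 then s else -s : ℝ), ?_, ?_⟩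
    · rw [dist_eq_norm, add_sub_cancel_left, EuclideanSpace.single, PiLp.norm_single, Real.norm_eq_abs]
      split_ifs
      · rw [abs_of_pos hs0]; linarith
      · rw [abs_neg, abs_of_pos hs0]; linarith
    · have e0 : (p + EuclideanSpace.single (0 : Fin 2) (if 0 < p 0 then s else -s : ℝ) : Momentum) 0 =
          p 0 + (if 0 < p 0 then s else -s) := by simp
      have e1 : (p + EuclideanSpace.single (0 : Fin 2) (if 0 < p 0 then s else -s : ℝ) : Momentum) 1 = p 1 := by
        simp
      rw [e0, e1]
      have := klfs_cos_push_lt h0 hs0 (by linarith [abs_nonneg (p 1)])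
      linarith
  · refine ⟨p + EuclideanSpace.single (1 : Fin 2) (if 0 < p 1 then s else -s : ℝ), ?_, ?_⟩
    · rw [dist_eq_norm, add_sub_cancel_left, EuclideanSpace.single, PiLp.norm_single, Real.norm_eq_abs]
      split_ifs
      · rw [abs_of_pos hs0]; linarith
      · rw [abs_neg, abs_of_pos hs0]; linarith
    · have e0 : (p + EuclideanSpace.single (1 : Fin 2) (if 0 < p 1 then s else -s : ℝ) : Momentum) 0 = p 0 := by
        simp
      have e1 : (p + EuclideanSpace.single (1 : Fin 2) (if 0 < p 1 then s else -s : ℝ) : Momentum) 1 =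
          p 1 + (if 0 < p 1 then s else -s) := by simp
      rw [e0, e1]
      have := klfs_cos_push_lt h1 hs0 (by linarith [abs_nonneg (p 0)])
      linarith

/-! ### §3 The closed Fermi sea `C_μ` and its properties -/

/-- Points of `C_μ = {|p₀| + |p₁| ≤ π, cos p₀ + cos p₁ ≥ -μ/2}` (`μ < 0`) lie in the OPEN diamond. [folklore] -/
theorem klfs_seaBody_abs_lt {μ : ℝ} (hμ : μ < 0) {p : Momentum}
    (hp : p ∈ {p : Momentum | |p 0| + |p 1| ≤ π ∧ -μ / 2 ≤ Real.cos (p 0) + Real.cos (p 1)}) :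
    |p 0| + |p 1| < π := by
  obtain ⟨h1, h2⟩ := hp
  exact abs_add_abs_lt_pi_of_cos_add_cos_pos (by linarith [abs_nonneg (p 1)]) (by linarith [abs_nonneg (p 0)])
    (by linarith)

/-- `C_μ` is closed. [folklore] -/
theorem klfs_isClosed_seaBody (μ : ℝ) :
    IsClosed {p : Momentum | |p 0| + |p 1| ≤ π ∧ -μ / 2 ≤ Real.cos (p 0) + Real.cos (p 1)} := by
  rw [Set.setOf_and]
  exact (isClosed_le (by fun_prop) continuous_const).inter (isClosed_le continuous_const (by fun_prop))

/-- `C_μ` is compact (closed, inside the cell `[-π, π]²`). [folklore] -/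
theorem klfs_isCompact_seaBody (μ : ℝ) :
    IsCompact {p : Momentum | |p 0| + |p 1| ≤ π ∧ -μ / 2 ≤ Real.cos (p 0) + Real.cos (p 1)} := by
  set K : Set Momentum := (fun y : Fin 2 → ℝ => WithLp.toLp 2 y) '' Set.pi univ (fun _ => Icc (-π) π) with hK
  have hKc : IsCompact K := (isCompact_univ_pi fun _ => isCompact_Icc).image (PiLp.continuous_toLp 2 _)
  refine hKc.of_isClosed_subset (klfs_isClosed_seaBody μ) fun p hp => ?_
  refine ⟨WithLp.ofLp p, fun i _ => ?_, rfl⟩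
  have h0 : |p 0| ≤ π := by linarith [abs_nonneg (p 1), hp.1]
  have h1 : |p 1| ≤ π := by linarith [abs_nonneg (p 0), hp.1]
  fin_cases i
  · exact ⟨(abs_le.1 h0).1, (abs_le.1 h0).2⟩
  · exact ⟨(abs_le.1 h1).1, (abs_le.1 h1).2⟩

/-- The strict superlevel set inside the open diamond is open and lies in the interior of `C_μ`. [folklore] -/
theorem klfs_superlevel_subset_interior (μ : ℝ) :
    {p : Momentum | |p 0| + |p 1| < π ∧ -μ / 2 < Real.cos (p 0) + Real.cos (p 1)} ⊆
      interior {p : Momentum | |p 0| + |p 1| ≤ π ∧ -μ / 2 ≤ Real.cos (p 0) + Real.cos (p 1)} := by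
  refine interior_maximal (fun p hp => ⟨hp.1.le, hp.2.le⟩) ?_
  rw [Set.setOf_and]
  exact (isOpen_lt (by fun_prop) continuous_const).inter (isOpen_lt continuous_const (by fun_prop))

/-- `0` is an interior point of `C_μ` (`-4 < μ`). [folklore] -/
theorem klfs_zero_mem_interior_seaBody {μ : ℝ} (hμ₁ : -4 < μ) :
    (0 : Momentum) ∈ interior {p : Momentum | |p 0| + |p 1| ≤ π ∧ -μ / 2 ≤ Real.cos (p 0) + Real.cos (p 1)} := by
  refine klfs_superlevel_subset_interior μ ⟨?_, ?_⟩
  · simp [Real.pi_pos]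
  · simp; linarith

/-- **The interior of `C_μ` is the strict superlevel set**: an interior point has `cos p₀ + cos p₁ > -μ/2`
(`-4 < μ < 0`; a level point is a limit of points outside `C_μ`, `klfs_exists_near_below`). [folklore] -/
theorem klfs_lt_of_mem_interior_seaBody {μ : ℝ} (hμ₁ : -4 < μ) (hμ₂ : μ < 0) {p : Momentum}
    (hp : p ∈ interior {p : Momentum | |p 0| + |p 1| ≤ π ∧ -μ / 2 ≤ Real.cos (p 0) + Real.cos (p 1)}) :
    -μ / 2 < Real.cos (p 0) + Real.cos (p 1) := by
  have hpC := interior_subset hp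
  have hlt := klfs_seaBody_abs_lt hμ₂ hpC
  by_contra hle
  push Not at hle
  have heq : Real.cos (p 0) + Real.cos (p 1) = -μ / 2 := le_antisymm hle hpC.2
  have hne : p ≠ 0 := by
    rintro rfl
    simp at heq; linarith
  rw [mem_interior_iff_mem_nhds, Metric.mem_nhds_iff] at hp
  obtain ⟨δ, hδ, hball⟩ := hp
  obtain ⟨q, hq, hlt'⟩ := klfs_exists_near_below hlt hne hδ
  have hqC := hball (Metric.mem_ball.2 hq)
  linarith [hqC.2]

/-- **The frontier of `C_μ` is the Fermi curve in the cell**: `frontier C_μ = S ∩ F` for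
`e = squareDispersion 1 0 · - μ` on `Crystal.cubic 2`, `-4 < μ < 0`. [folklore] -/
theorem klfs_frontier_seaBody {μ : ℝ} (hμ₁ : -4 < μ) (hμ₂ : μ < 0) :
    (FermiRG.Crystal.cubic 2).fermiSurfaceRep (fun q : Momentum => squareDispersion 1 0 q - μ) =
      frontier {p : Momentum | |p 0| + |p 1| ≤ π ∧ -μ / 2 ≤ Real.cos (p 0) + Real.cos (p 1)} := by
  rw [(klfs_isClosed_seaBody μ).frontier_eq]
  ext p
  rw [FermiRG.Crystal.mem_fermiSurfaceRep, klfs_mem_cubic_fundamentalDomain, mem_sdiff]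
  have he : squareDispersion 1 0 p - μ = 0 ↔ Real.cos (p 0) + Real.cos (p 1) = -μ / 2 := by
    simp only [squareDispersion]
    constructor <;> intro h <;> linarith
  rw [he]
  constructor
  · rintro ⟨hlev, hF⟩
    have habs : ∀ i, |p i| ≤ π := fun i => abs_le.2 ⟨(hF i).1, (hF i).2.le⟩
    have hlt : |p 0| + |p 1| < π :=
      abs_add_abs_lt_pi_of_cos_add_cos_pos (habs 0) (habs 1) (by rw [hlev]; linarith)
    refine ⟨⟨hlt.le, hlev.symm.le⟩, fun hint => ?_⟩
    have := klfs_lt_of_mem_interior_seaBody hμ₁ hμ₂ hint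
    linarith
  · rintro ⟨hpC, hnint⟩
    have hlt := klfs_seaBody_abs_lt hμ₂ hpC
    have hle : Real.cos (p 0) + Real.cos (p 1) ≤ -μ / 2 := by
      by_contra h
      push Not at h
      exact hnint (klfs_superlevel_subset_interior μ ⟨hlt, h⟩)
    refine ⟨le_antisymm hle hpC.2, fun i => ?_⟩
    have h0 : |p 0| < π := by linarith [abs_nonneg (p 1)]
    have h1 : |p 1| < π := by linarith [abs_nonneg (p 0)]
    fin_cases i
    · exact ⟨(abs_lt.1 h0).1.le, (abs_lt.1 h0).2⟩
    · exact ⟨(abs_lt.1 h1).1.le, (abs_lt.1 h1).2⟩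

/-- **`C_μ` is strictly convex** (`μ < 0`): a proper convex combination of two distinct points of
`C_μ` lies in the open diamond with `cos + cos > -μ/2`, i.e. in the interior. [folklore] -/
theorem klfs_strictConvex_seaBody {μ : ℝ} (hμ₂ : μ < 0) :
    StrictConvex ℝ {p : Momentum | |p 0| + |p 1| ≤ π ∧ -μ / 2 ≤ Real.cos (p 0) + Real.cos (p 1)} := by
  intro x hx y hy hxy a b ha hb hab
  have hx' := klfs_seaBody_abs_lt hμ₂ hx
  have hy' := klfs_seaBody_abs_lt hμ₂ hy
  refine klfs_superlevel_subset_interior μ ⟨klfs_diamond_combo hx' hy' ha hb hab, ?_⟩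
  exact klfs_cos_add_cos_combo_gt (by linarith) hx' hy' hxy hx.2 hy.2 ha hb hab

/-! ### §4 (A3), global form -/

/-- **FST II (A3), GLOBAL form, for the Hubbard band** (Feldman–Salmhofer–Trubowitz, CPAM 51 (1998) 1133,
Assumption A3 p.7 L59–60: "`S` bounds a strictly convex region", as typed by `FermiRG.HypA3Global`):
for `e = squareDispersion 1 0 · - μ` on `Crystal.cubic 2` and every `-4 < μ < 0`, the representatives
`S ∩ F` of the Fermi surface are the frontier of the compact strictly convex body
`C_μ = {|p₀| + |p₁| ≤ π, cos p₀ + cos p₁ ≥ -μ/2}` with non-empty interior. Together with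
`klfs_hypA2`, `klfs_hypA3` (local), `klfs_hypA4`, `klfs_hypSy` and `klfs_not_hypA5` this completes the
typed FST II hypothesis set for the Hubbard band on the whole hole-doped range. [folklore] -/
theorem klfs_hypA3Global {μ : ℝ} (hμ₁ : -4 < μ) (hμ₂ : μ < 0) :
    FermiRG.HypA3Global (FermiRG.Crystal.cubic 2) (fun q : Momentum => squareDispersion 1 0 q - μ) :=
  ⟨{p : Momentum | |p 0| + |p 1| ≤ π ∧ -μ / 2 ≤ Real.cos (p 0) + Real.cos (p 1)},
    klfs_isCompact_seaBody μ, klfs_strictConvex_seaBody hμ₂, ⟨0, klfs_zero_mem_interior_seaBody hμ₁⟩,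
    klfs_frontier_seaBody hμ₁ hμ₂⟩

/-- **On the certified window** `μ ∈ [-0.4267, -0.1798]` and **on the analysis window** `[-1, -0.15]`:
(A3) global holds. [folklore] -/
theorem klfs_windows_hypA3Global {μ : ℝ}
    (hμ : μ ∈ Icc (-0.4267 : ℝ) (-0.1798) ∨ μ ∈ Icc (-1 : ℝ) (-0.15)) :
    FermiRG.HypA3Global (FermiRG.Crystal.cubic 2) (fun q : Momentum => squareDispersion 1 0 q - μ) := by
  rcases hμ with h | h
  · exact klfs_hypA3Global (by linarith [h.1]) (by linarith [h.2])
  · exact klfs_hypA3Global (by linarith [h.1]) (by linarith [h.2])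

end Summit.HubbardSuperconductivity.HubbardSuperconductivity.Theorems

end
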